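import Literature.AlgebraicGeometry.Morphisms.CechH1FlatBaseChange
import Literature.AlgebraicGeometry.Morphisms.CechH1RestrictBase
import Mathlib.LinearAlgebra.Isomorphisms
import Mathlib.RingTheory.Flat.Basic
import HarnessLib

/-!
# Flat base change of Čech `Ȟ¹(𝒰, 𝒪_X)`: `B ⊗_A Ȟ¹(𝒰, 𝒪_X) ≃ₗ[B] Ȟ¹(g⁻¹𝒰, 𝒪_Z)`; ranks

Layer `Literature/AlgebraicGeometry/Morphisms`, namespace `Literature.AlgebraicGeometry.Morphisms`.  THEOREMS ONLY (no definition, no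
named fact, no instance, no `sorry`): every map below is built inside a proof and exported through an `∃`/`Nonempty` statement.

For a cartesian square of schemes over affine bases
```
      Z ──g──▶ X
   f_Z│        │f_X
      ▼        ▼
   Spec B ──▶ Spec A
```
(`IsPullback g f_Z f_X (Spec (A → B))`), `X` quasi-separated, `𝒰 = (U_i)` a FINITE family of AFFINE opens of `X` and `A → B` FLAT, this
is FLAT BASE CHANGE IN DEGREE ONE (The Stacks Project, Tag 02KH; EGA III₁ (1.4.15); Hartshorne III Prop. 9.3) on the tree's Čech
carrier ★ `Morphisms/CechH1`: the base-change maps of cochains `B ⊗_A Čᵖ(𝒰, 𝒪_X) → Čᵖ(g⁻¹𝒰, 𝒪_Z)` of ★ `Morphisms/CechH1FlatBaseChange`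
(`bcC0`, `bcC1`, `bcC2`, `A`-linear into the cochains of the `A`-scheme `Z → Spec B → Spec A`) are read over `B` through the identity
casts of ★ `Morphisms/CechH1RestrictBase` (`(Sections.equiv f_Z W)⁻¹ ∘ Sections.equiv (f_Z|_A) W`, both `RingEquiv.refl`), and

* `bcC1_tmul_cast` — `bcC1 (b ⊗ c) = b · g^*c` read over `B`;
* `exists_linearMap_bcC1` — the cochain map `B ⊗_A Č¹(𝒰, 𝒪_X) → Č¹(g⁻¹𝒰, 𝒪_Z)` IS `B`-LINEAR (exported as `∃ Φ, Φ = bcC1` pointwise);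
* **`exists_cechH1_baseChange_linearEquiv`** — for `A → B` flat: a `B`-LINEAR EQUIVALENCE `B ⊗_A Ȟ¹(𝒰, 𝒪_X) ≃ₗ[B] Ȟ¹(g⁻¹𝒰, 𝒪_Z)` with
  `b ⊗ [z] ↦ b · [g^*z]`; `nonempty_cechH1_baseChange_linearEquiv`, **`finrank_cechH1_baseChange`**
  (`finrank_B Ȟ¹(g⁻¹𝒰, 𝒪_Z) = finrank_B (B ⊗_A Ȟ¹(𝒰, 𝒪_X))`) and `finite_cechH1_baseChange_iff`.

Proof: `B ⊗_A –` is exact (`Module.Flat.lTensor_exact`, `Module.Flat.lTensor_preserves_injective_linearMap`) and right exact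
(`lTensor_exact`, `LinearMap.lTensor_surjective`), so `B ⊗ Ž¹ = ker (1 ⊗ d¹)` and `B ⊗ Ȟ¹ = (B ⊗ Ž¹)/(1 ⊗ d⁰)(B ⊗ Č⁰)`; the cochain
comparison maps (bijective in degrees `≤ 1`, injective in degree `2`: ★ `bcPi_bijective`, `bcC1_bijective`, `bcC2_injective`)
identify these with `Ž¹(g⁻¹𝒰)` and `Ȟ¹(g⁻¹𝒰)`; the `Ȟ¹`-map is the factorisation of `[·] ∘ (B ⊗ Ž¹ → Ž¹(g⁻¹𝒰))` through
`(1 ⊗ [·]) : B ⊗ Ž¹ → B ⊗ Ȟ¹` (`LinearMap.quotKerEquivOfSurjective`, `Submodule.liftQ`).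
Cell `hodgecm-mathlib`, F-3 (M-c)(c2) transport brick (B-p07 (g20) census, (g21) theorems-only re-cut); consumed by
`AbelianVarieties/CechH1DimOfCharZeroByTransport` (`dim_K Ȟ¹(A, 𝒪) = dim A` for every field `K` of characteristic `0`).
HC_CM is proved only modulo the 7 printed citations until rung 0 closes; nothing here is about HC.

## References
* [StacksProject] The Stacks Project, Tag 02KH (Cohomology of Schemes, Lemma 30.5.2: flat base change), Tag 01ED (Čech cohomology).
* [EGAIII1] A. Grothendieck, J. Dieudonné, EGA III₁ (Publ. Math. IHÉS 11, 1961), Prop. (1.4.15).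
* [Hartshorne1977] R. Hartshorne, *Algebraic Geometry* (1977), III Prop. 9.3 (p. 255).
-/

set_option autoImplicit false

open CategoryTheory AlgebraicGeometry Limits TopologicalSpace Opposite TensorProduct

universe u v

namespace Literature.AlgebraicGeometry.Morphisms

/-- An additive map `F : B ⊗_A M → N` into a `B`-module with `F((b·b') ⊗ m) = b · F(b' ⊗ m)` commutes with the `B`-action.
[folklore] -/
private theorem map_smul_of_tmul {A B : Type u} [CommRing A] [CommRing B] [Algebra A B] {M : Type*} {N : Type*}
    [AddCommGroup M] [Module A M] [AddCommGroup N] [Module B N] (F : B ⊗[A] M →+ N)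
    (hF : ∀ (b b' : B) (m : M), F ((b * b') ⊗ₜ m) = b • F (b' ⊗ₜ m)) (b : B) (T : B ⊗[A] M) :
    F (b • T) = b • F T := by
  induction T using TensorProduct.induction_on with
  | zero => rw [smul_zero, map_zero, smul_zero]
  | tmul b' m => rw [TensorProduct.smul_tmul', smul_eq_mul, hF]
  | add x y hx hy => rw [smul_add, map_add, hx, hy, map_add, smul_add]

variable {A B : Type u} [CommRing A] [CommRing B] [Algebra A B] {X Z : Scheme.{u}}
  (fX : X ⟶ Spec (.of A)) (fZ : Z ⟶ Spec (.of B)) (g : Z ⟶ X)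
  (hg : g ≫ fX = restrictBase A fZ) {ι : Type v} (U : ι → X.Opens)

/-! ## §1 The cochain base-change maps read over `B` -/

section Cochains

/-- The identity cast of the structure map `f_Z^*(b)` (★ `toSectionsBase`, `A`-typed) is `algebraMap B Γ(Z, W) b`. [folklore] -/
private theorem cast_toSectionsBase (W : Z.Opens) (b : B) :
    (Sections.equiv fZ W).symm (Sections.equiv (restrictBase A fZ) W (toSectionsBase A fZ W b)) =
      algebraMap B (Sections fZ W) b := rfl

/-- **`bcC1 (b ⊗ c)_{ij} = b · g^*(c_{ij})` read over `B`** (the pulled-back cochain ★ `cechComapC1` of the `A`-scheme `Z → Spec B → Spec A`,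
cast to the `B`-scheme `Z → Spec B`). [cite: StacksProject, Tag 02KH] -/
theorem bcC1_tmul_cast (b : B) (c : CechC1 fX U) (i j : ι) :
    (Sections.equiv fZ _).symm (Sections.equiv (restrictBase A fZ) _ (bcC1 fX fZ g hg U (b ⊗ₜ c) i j)) =
      algebraMap B (Sections fZ _) b *
        (Sections.equiv fZ _).symm (Sections.equiv (restrictBase A fZ) _ (cechComapC1 fX (restrictBase A fZ) g hg U c i j)) :=
  rfl

/-- **The cochain base-change map `B ⊗_A Č¹(𝒰, 𝒪_X) → Č¹(g⁻¹𝒰, 𝒪_Z)` is `B`-linear**: there is a `B`-linear map agreeing pointwise with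
★ `bcC1` read over `B` (`B`-linearity is read on pure tensors, `bcC1 ((b·b') ⊗ c) = b · bcC1 (b' ⊗ c)`). [cite: StacksProject, Tag 02KH] -/
theorem exists_linearMap_bcC1 :
    ∃ Φ : B ⊗[A] CechC1 fX U →ₗ[B] CechC1 fZ (preimageFamily g U),
      ∀ T i j, Φ T i j = (Sections.equiv fZ _).symm (Sections.equiv (restrictBase A fZ) _ (bcC1 fX fZ g hg U T i j)) := by
  let F : B ⊗[A] CechC1 fX U →+ CechC1 fZ (preimageFamily g U) :=
    { toFun := fun T i j => (Sections.equiv fZ _).symm (Sections.equiv (restrictBase A fZ) _ (bcC1 fX fZ g hg U T i j))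
      map_zero' := by funext i j; simp only [map_zero, Pi.zero_apply]
      map_add' := fun T T' => by funext i j; simp only [map_add, Pi.add_apply] }
  have hF : ∀ (b b' : B) (c : CechC1 fX U), F ((b * b') ⊗ₜ c) = b • F (b' ⊗ₜ c) := by
    intro b b' c
    funext i j
    change (Sections.equiv fZ _).symm (Sections.equiv (restrictBase A fZ) _ (bcC1 fX fZ g hg U ((b * b') ⊗ₜ c) i j)) =
      b • (Sections.equiv fZ _).symm (Sections.equiv (restrictBase A fZ) _ (bcC1 fX fZ g hg U (b' ⊗ₜ c) i j))
    rw [bcC1_tmul_cast, bcC1_tmul_cast, map_mul, Algebra.smul_def, mul_assoc]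
  exact ⟨{ toFun := F, map_add' := F.map_add, map_smul' := fun b T => map_smul_of_tmul F hF b T }, fun T i j => rfl⟩

/-- **`B ⊗_A Č⁰(𝒰) → Č⁰(g⁻¹𝒰)` is surjective** for `𝒰` finite affine, `X` quasi-separated, `A → B` flat (★ `bcPi_bijective` in degree `0`,
read over `B`). [cite: StacksProject, Tag 02KH] -/
theorem exists_bcC0_cast_eq [Finite ι] [QuasiSeparatedSpace X] [Module.Flat A B]
    (H : IsPullback g fZ fX (Spec.map (CommRingCat.ofHom (algebraMap A B)))) (hU : ∀ i, IsAffineOpen (U i))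
    (w : CechC0 fZ (preimageFamily g U)) :
    ∃ S : B ⊗[A] CechC0 fX U,
      (fun i => (Sections.equiv fZ _).symm (Sections.equiv (restrictBase A fZ) _ (bcC0 fX fZ g H.w U S i))) = w := by
  have h := (bcPi_bijective fX fZ g U (preimageFamily g U) (fun _ => le_rfl) H (fun i => (hU i).isCompact)
    (fun i => isQuasiSeparated_univ.of_subset (Set.subset_univ _)) (fun _ => le_rfl)).2
  obtain ⟨S, hS⟩ := h (fun i => (Sections.equiv (restrictBase A fZ) _).symm (Sections.equiv fZ _ (w i)))
  refine ⟨S, funext fun i => ?_⟩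
  rw [show bcC0 fX fZ g H.w U S = _ from hS]
  rfl

/-- **`B ⊗_A Č¹(𝒰) → Č¹(g⁻¹𝒰)` read over `B` is bijective** (★ `bcC1_bijective`). [cite: StacksProject, Tag 02KH] -/
theorem bijective_of_eq_bcC1_cast [Finite ι] [QuasiSeparatedSpace X] [Module.Flat A B]
    (H : IsPullback g fZ fX (Spec.map (CommRingCat.ofHom (algebraMap A B)))) (hU : ∀ i, IsAffineOpen (U i))
    (Φ : B ⊗[A] CechC1 fX U →ₗ[B] CechC1 fZ (preimageFamily g U))
    (hΦ : ∀ T i j, Φ T i j = (Sections.equiv fZ _).symm (Sections.equiv (restrictBase A fZ) _ (bcC1 fX fZ g H.w U T i j))) :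
    Function.Bijective Φ := by
  refine ⟨fun T T' h => (bcC1_bijective fX fZ g U H hU).1 (funext fun i => funext fun j => ?_), fun c => ?_⟩
  · have hij := congrFun (congrFun h i) j
    rw [hΦ, hΦ] at hij
    exact hij
  · obtain ⟨T, hT⟩ := (bcC1_bijective fX fZ g U H hU).2
      (fun i j => (Sections.equiv (restrictBase A fZ) _).symm (Sections.equiv fZ _ (c i j)))
    refine ⟨T, funext fun i => funext fun j => ?_⟩
    rw [hΦ, hT]
    rfl

/-- **`B ⊗_A Č²(𝒰) → Č²(g⁻¹𝒰)` read over `B` is injective** (★ `bcC2_injective`). [cite: StacksProject, Tag 02KH] -/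
theorem bcC2_cast_injective [Finite ι] [QuasiSeparatedSpace X] [Module.Flat A B]
    (H : IsPullback g fZ fX (Spec.map (CommRingCat.ofHom (algebraMap A B)))) (hU : ∀ i, IsAffineOpen (U i)) :
    Function.Injective fun (T : B ⊗[A] CechC2 fX U) (i j k : ι) =>
      (Sections.equiv fZ _).symm (Sections.equiv (restrictBase A fZ) _ (bcC2 fX fZ g H.w U T i j k)) := by
  intro T T' h
  exact bcC2_injective fX fZ g U H hU (funext fun i => funext fun j => funext fun k =>
    (congrFun (congrFun (congrFun h i) j) k :))

end Cochains

/-! ## §2 `Ȟ¹` -/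

section H1

/-- **FLAT BASE CHANGE OF `Ȟ¹` (degree-one case of Stacks 02KH)**: for the cartesian square `Z = X ×_{Spec A} Spec B` with `A → B` flat,
`X` quasi-separated and `𝒰` a finite family of affine opens, there is a `B`-LINEAR EQUIVALENCE
`B ⊗_A Ȟ¹(𝒰, 𝒪_X) ≃ₗ[B] Ȟ¹(g⁻¹𝒰, 𝒪_Z)` sending `b ⊗ [z]` to `b · [g^*z]` (the pulled-back cocycle ★ `cechComapC1` read over `B`).
Surjectivity: a cocycle downstairs is `bcC1 T` with `(1 ⊗ d¹)T = 0` by injectivity of `bcC2`, and `ker (1 ⊗ d¹) = B ⊗ Ž¹` by flatness;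
injectivity: a class killed downstairs has `bcC1`-preimage in `(1 ⊗ d⁰)(B ⊗ Č⁰)` by surjectivity of `bcC0`, and `1 ⊗ (Ž¹ ↪ Č¹)` is injective
by flatness. [cite: StacksProject, Tag 02KH (Cohomology of Schemes, Lemma 30.5.2)] [cite: Hartshorne1977, III Prop. 9.3 (p. 255)]
[cite: EGAIII1, Prop. (1.4.15)] -/
theorem exists_cechH1_baseChange_linearEquiv [Finite ι] [QuasiSeparatedSpace X] [Module.Flat A B]
    (H : IsPullback g fZ fX (Spec.map (CommRingCat.ofHom (algebraMap A B)))) (hU : ∀ i, IsAffineOpen (U i)) :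
    ∃ e : B ⊗[A] CechH1 fX U ≃ₗ[B] CechH1 fZ (preimageFamily g U),
      ∀ (b : B) (z : cechZ1 fX U),
        e (b ⊗ₜ CechH1.mk fX U z) =
          b • CechH1.mk fZ (preimageFamily g U)
            ⟨fun i j => (Sections.equiv fZ _).symm (Sections.equiv (restrictBase A fZ) _
                (cechComapC1 fX (restrictBase A fZ) g H.w U z i j)),
              (mem_cechZ1_iff_restrictBase fZ (preimageFamily g U) _).2
                (comapC1_mem_cechZ1 fX (restrictBase A fZ) g H.w U z.2)⟩ := by
  obtain ⟨Φ, hΦ⟩ := exists_linearMap_bcC1 fX fZ g H.w U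
  have hΦbij := bijective_of_eq_bcC1_cast fX fZ g U H hU Φ hΦ
  -- pointwise descriptions of `Φ`
  have hΦfun : ∀ T, Φ T = fun i j =>
      (Sections.equiv fZ _).symm (Sections.equiv (restrictBase A fZ) _ (bcC1 fX fZ g H.w U T i j)) :=
    fun T => funext fun i => funext fun j => hΦ T i j
  -- (a) `Φ ∘ (1 ⊗ ι)` lands in the cocycles: base change commutes with `d¹`
  have hΦZ : ∀ T : B ⊗[A] ↥(cechZ1 fX U), Φ (((cechZ1 fX U).subtype.baseChange B) T) ∈ cechZ1 fZ (preimageFamily g U) := by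
    intro T
    have hcomp : cechD1 fX U ∘ₗ (cechZ1 fX U).subtype = 0 := LinearMap.comp_ker_subtype (cechD1 fX U)
    rw [hΦfun, mem_cechZ1_iff_restrictBase, mem_cechZ1_iff, ← bcC2_lTensor_cechD1,
      show ((cechZ1 fX U).subtype.baseChange B) T = LinearMap.lTensor B (cechZ1 fX U).subtype T from
        congrFun (LinearMap.baseChange_eq_ltensor _) T,
      ← LinearMap.comp_apply (LinearMap.lTensor B (cechD1 fX U)), ← LinearMap.lTensor_comp, hcomp,
      LinearMap.lTensor_zero, LinearMap.zero_apply, map_zero]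
  set Ψ : B ⊗[A] ↥(cechZ1 fX U) →ₗ[B] ↥(cechZ1 fZ (preimageFamily g U)) := LinearMap.codRestrict (cechZ1 fZ (preimageFamily g U)) (Φ ∘ₗ (cechZ1 fX U).subtype.baseChange B) hΦZ with hΨ
  have hΨcoe : ∀ T, ((Ψ T : ↥(cechZ1 fZ (preimageFamily g U))) : CechC1 fZ (preimageFamily g U)) = Φ (LinearMap.lTensor B (cechZ1 fX U).subtype T) := by
    intro T
    rw [hΨ, LinearMap.codRestrict_apply, LinearMap.comp_apply,
      show ((cechZ1 fX U).subtype.baseChange B) T = LinearMap.lTensor B (cechZ1 fX U).subtype T from congrFun (LinearMap.baseChange_eq_ltensor _) T]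
  -- (b) `1 ⊗ [·] : B ⊗ Ž¹ → B ⊗ Ȟ¹` is surjective with kernel `(1 ⊗ d⁰)(B ⊗ Č⁰)`
  set mkB := (CechH1.mk fX U).baseChange B with hmkBdef
  have hmkB : ∀ T, mkB T = LinearMap.lTensor B (CechH1.mk fX U) T := fun T => congrFun (LinearMap.baseChange_eq_ltensor _) T
  have hmkXsurj : Function.Surjective (CechH1.mk fX U) := CechH1.mk_surjective fX U
  have hsurj : Function.Surjective mkB := by
    rw [show (⇑mkB) = ⇑(LinearMap.lTensor B (CechH1.mk fX U)) from LinearMap.baseChange_eq_ltensor _]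
    exact LinearMap.lTensor_surjective B hmkXsurj
  set d0Z : CechC0 fX U →ₗ[A] ↥(cechZ1 fX U) :=
    LinearMap.codRestrict (cechZ1 fX U) (cechD0 fX U) fun e => (mem_cechZ1_iff fX U _).2 (cechD1_cechD0 fX U e) with hd0Z
  have hexX : Function.Exact d0Z (CechH1.mk fX U) := by
    intro z
    rw [CechH1.mk_eq_zero_iff, mem_cechB1_iff]
    constructor
    · rintro ⟨e, he⟩
      exact ⟨e, Subtype.ext he⟩
    · rintro ⟨e, rfl⟩
      exact ⟨e, rfl⟩
  have hexB : Function.Exact (LinearMap.lTensor B d0Z) (LinearMap.lTensor B (CechH1.mk fX U)) := lTensor_exact B hexX hmkXsurj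
  -- (c) kernel containment: `[·] ∘ Ψ` kills `(1 ⊗ d⁰)(B ⊗ Č⁰)` (base change commutes with `d⁰`)
  have hΨd0 : ∀ S : B ⊗[A] CechC0 fX U, CechH1.mk fZ (preimageFamily g U) (Ψ (LinearMap.lTensor B d0Z S)) = 0 := by
    intro S
    rw [CechH1.mk_eq_zero_iff, hΨcoe, ← LinearMap.comp_apply (LinearMap.lTensor B (cechZ1 fX U).subtype),
      ← LinearMap.lTensor_comp, hd0Z, LinearMap.subtype_comp_codRestrict, hΦfun, bcC1_lTensor_cechD0,
      mem_cechB1_iff_restrictBase, mem_cechB1_iff]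
    exact ⟨_, rfl⟩
  have hker : LinearMap.ker mkB ≤ LinearMap.ker (CechH1.mk fZ (preimageFamily g U) ∘ₗ Ψ) := by
    intro T hT
    rw [LinearMap.mem_ker, hmkB] at hT
    obtain ⟨S, rfl⟩ := (hexB T).1 hT
    rw [LinearMap.mem_ker, LinearMap.comp_apply]
    exact hΨd0 S
  -- (d) the `Ȟ¹`-map `φ`, `φ ((1 ⊗ [·]) T) = [Ψ T]`
  set φ : B ⊗[A] CechH1 fX U →ₗ[B] CechH1 fZ (preimageFamily g U) :=
    (LinearMap.ker mkB).liftQ (CechH1.mk fZ (preimageFamily g U) ∘ₗ Ψ) hker ∘ₗ (mkB.quotKerEquivOfSurjective hsurj).symm.toLinearMap with hφdef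
  have hφ : ∀ T, φ (LinearMap.lTensor B (CechH1.mk fX U) T) = CechH1.mk fZ (preimageFamily g U) (Ψ T) := by
    intro T
    rw [hφdef, LinearMap.comp_apply, LinearEquiv.coe_toLinearMap, ← hmkB, LinearMap.quotKerEquivOfSurjective_symm_apply,
      Submodule.liftQ_apply, LinearMap.comp_apply]
  -- (e) surjectivity
  have hφsurj : Function.Surjective φ := by
    intro q
    obtain ⟨z, rfl⟩ := CechH1.mk_surjective fZ (preimageFamily g U) q
    obtain ⟨T, hT⟩ := hΦbij.2 (z : CechC1 fZ (preimageFamily g U))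
    -- `(1 ⊗ d¹) T = 0`
    have hT0 : LinearMap.lTensor B (cechD1 fX U) T = 0 := by
      apply bcC2_cast_injective fX fZ g U H hU
      funext i j k
      change (Sections.equiv fZ _).symm (Sections.equiv (restrictBase A fZ) _
          (bcC2 fX fZ g H.w U (LinearMap.lTensor B (cechD1 fX U) T) i j k)) =
        (Sections.equiv fZ _).symm (Sections.equiv (restrictBase A fZ) _ (bcC2 fX fZ g H.w U 0 i j k))
      have hz : cechD1 fZ (preimageFamily g U) (Φ T) = 0 := by
        rw [hT]; exact (mem_cechZ1_iff fZ _ _).1 z.2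
      rw [hΦfun] at hz
      have hz' := congrFun (congrFun (congrFun hz i) j) k
      rw [bcC2_lTensor_cechD1, map_zero]
      exact hz'
    -- so `T = (1 ⊗ ι) T'` with `T' ∈ B ⊗ Ž¹`
    have hex : Function.Exact (LinearMap.lTensor B (cechZ1 fX U).subtype) (LinearMap.lTensor B (cechD1 fX U)) :=
      Module.Flat.lTensor_exact B (LinearMap.exact_subtype_ker_map (cechD1 fX U))
    obtain ⟨T', rfl⟩ := (hex T).1 hT0
    refine ⟨LinearMap.lTensor B (CechH1.mk fX U) T', ?_⟩
    rw [hφ]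
    congr 1
    exact Subtype.ext ((hΨcoe T').trans hT)
  -- (f) injectivity
  have hφinj : Function.Injective φ := by
    rw [injective_iff_map_eq_zero]
    intro ξ hξ
    obtain ⟨T', rfl⟩ := LinearMap.lTensor_surjective B hmkXsurj ξ
    rw [hφ, CechH1.mk_eq_zero_iff, mem_cechB1_iff] at hξ
    obtain ⟨w, hw⟩ := hξ
    obtain ⟨S, rfl⟩ := exists_bcC0_cast_eq fX fZ g U H hU w
    -- `Φ ((1 ⊗ ι) T') = d⁰ (bcC0 S) = Φ ((1 ⊗ d⁰) S)`
    have h1 : Φ (LinearMap.lTensor B (cechZ1 fX U).subtype T') = Φ (LinearMap.lTensor B (cechD0 fX U) S) := by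
      rw [← hΨcoe, ← hw, hΦfun (LinearMap.lTensor B (cechD0 fX U) S), bcC1_lTensor_cechD0]
      rfl
    have h2 : LinearMap.lTensor B (cechZ1 fX U).subtype T' = LinearMap.lTensor B (cechZ1 fX U).subtype (LinearMap.lTensor B d0Z S) := by
      rw [hΦbij.1 h1, ← LinearMap.comp_apply (LinearMap.lTensor B (cechZ1 fX U).subtype), ← LinearMap.lTensor_comp, hd0Z,
        LinearMap.subtype_comp_codRestrict]
    have h3 : T' = LinearMap.lTensor B d0Z S :=
      Module.Flat.lTensor_preserves_injective_linearMap (M := B) (cechZ1 fX U).subtype Subtype.val_injective h2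
    rw [h3, (hexB _).2 ⟨S, rfl⟩]
  -- (g) the equivalence and its formula on pure tensors
  refine ⟨LinearEquiv.ofBijective φ ⟨hφinj, hφsurj⟩, fun b z => ?_⟩
  rw [LinearEquiv.ofBijective_apply, ← LinearMap.lTensor_tmul, hφ, ← map_smul]
  congr 1
  apply Subtype.ext
  rw [hΨcoe, LinearMap.lTensor_tmul, Submodule.coe_subtype, Submodule.coe_smul, hΦfun]
  funext i j
  rw [Pi.smul_apply, Pi.smul_apply, Algebra.smul_def]
  exact bcC1_tmul_cast fX fZ g H.w U b z i j

/-- **`B ⊗_A Ȟ¹(𝒰, 𝒪_X) ≃ₗ[B] Ȟ¹(g⁻¹𝒰, 𝒪_Z)`** under flat base change (existence of the `B`-linear equivalence).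
[cite: StacksProject, Tag 02KH] [cite: EGAIII1, Prop. (1.4.15)] -/
theorem nonempty_cechH1_baseChange_linearEquiv [Finite ι] [QuasiSeparatedSpace X] [Module.Flat A B]
    (H : IsPullback g fZ fX (Spec.map (CommRingCat.ofHom (algebraMap A B)))) (hU : ∀ i, IsAffineOpen (U i)) :
    Nonempty (B ⊗[A] CechH1 fX U ≃ₗ[B] CechH1 fZ (preimageFamily g U)) := by
  obtain ⟨e, -⟩ := exists_cechH1_baseChange_linearEquiv fX fZ g U H hU
  exact ⟨e⟩

/-- **Ranks under flat base change**: `finrank_B Ȟ¹(g⁻¹𝒰, 𝒪_Z) = finrank_B (B ⊗_A Ȟ¹(𝒰, 𝒪_X))`.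
[cite: StacksProject, Tag 02KH] [cite: Hartshorne1977, III Prop. 9.3 (p. 255)] -/
theorem finrank_cechH1_baseChange [Finite ι] [QuasiSeparatedSpace X] [Module.Flat A B]
    (H : IsPullback g fZ fX (Spec.map (CommRingCat.ofHom (algebraMap A B)))) (hU : ∀ i, IsAffineOpen (U i)) :
    Module.finrank B (CechH1 fZ (preimageFamily g U)) = Module.finrank B (B ⊗[A] CechH1 fX U) := by
  obtain ⟨e⟩ := nonempty_cechH1_baseChange_linearEquiv fX fZ g U H hU
  exact e.finrank_eq.symm

/-- `Module.Finite` under flat base change: `Ȟ¹(g⁻¹𝒰, 𝒪_Z)` is a finite `B`-module iff `B ⊗_A Ȟ¹(𝒰, 𝒪_X)` is.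
[cite: StacksProject, Tag 02KH] -/
theorem finite_cechH1_baseChange_iff [Finite ι] [QuasiSeparatedSpace X] [Module.Flat A B]
    (H : IsPullback g fZ fX (Spec.map (CommRingCat.ofHom (algebraMap A B)))) (hU : ∀ i, IsAffineOpen (U i)) :
    Module.Finite B (CechH1 fZ (preimageFamily g U)) ↔ Module.Finite B (B ⊗[A] CechH1 fX U) := by
  obtain ⟨e⟩ := nonempty_cechH1_baseChange_linearEquiv fX fZ g U H hU
  exact ⟨fun _ => Module.Finite.equiv e.symm, fun _ => Module.Finite.equiv e⟩

end H1

end Literature.AlgebraicGeometry.Morphisms
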